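import Mathlib.Analysis.SpecialFunctions.Pow.Integral
import Mathlib.Analysis.SpecificLimits.Basic
import Literature.Analysis.FluidPDE.MultiplicativeInequality
import HarnessLib

/-!
# Tsai 1998, (4.1)–(4.3): the weighted `L^{10/3}` bound of a self-similar profile on dyadic shells

Analysis/FluidPDE proofs-layer file (theorems only) in the decomposition of the named fact
`Literature.Analysis.FluidPDE.tsai1998_lemma41` (`TsaiLocalEnergy`; T.-P. Tsai, *On Leray's
self-similar solutions of the Navier–Stokes equations satisfying local energy estimates*, Arch.
Rational Mech. Anal. 143 (1998), Lemma 4.1). On p. 44–45 Tsai deduces from the local energy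
estimates (1.4) for the self-similar field `u` the weighted bound

  **(4.3)** `∫_{ℝ³} |U(y)|^{10/3} w(y) dy < ∞`, `w(y) = |y|^{-5/3}`,

on the profile: "By [CKN, p. 781], (1.4) implies `‖u‖_{10/3,Q₁} < ∞`" (the parabolic
interpolation `L^∞L² ∩ L²H¹ ⊂ L^{10/3}`), then the change of variables (4.1), and "Since `U` is
smooth, the condition (4.1)₂ `< ∞` implies (4.3)". (4.3) is the hypothesis under which the
weighted Calderón–Zygmund theory produces the pressure `P̃ ∈ L^{5/3}_w` (the tree's named fact
`tsai1998_pressure_L53w`, `TsaiSelfSimilarPressure`).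

This file proves (4.3) in the profile variables, from the two bounds that (1.4) leaves after
the change of variables (4.1) (`TsaiLocalEnergyScaling`: `setLIntegral_ball_profile_sq_le`,
`lintegral_frobeniusNormSq_profile_weight_lt_top`):

* `lintegral_rpow_ten_thirds_weight_lt_top`: if `U ∈ C¹(ℝ³; ℝ³)`, `∫_{B_r} |U|² ≤ C r` for
  `r ≥ R₀` and `∫ |DU|² min(1, |y|⁻¹) dy < ∞`, then `∫ |U|^{10/3} |y|^{-5/3} dy < ∞`.

The interpolation is run on dyadic shells `{R ≤ |y| < 2R}` (where both weights are constant up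
to factors) with the annular cut-offs `η_R = χ_{2R} − χ_{R/2}` built from the tree's `cutoff`
(`WholeSpaceIBP`): by the multiplicative inequality of `MultiplicativeInequality`
(`‖V‖_{10/3} ≤ K^{3/5}‖V‖₂^{2/5}‖DV‖₂^{3/5}` for `C¹` maps in `L²`; Escauriaza–Seregin–Šverák 2003,
(3.7)) applied to `V = η_R U`,
`∫_{R≤|y|<2R} |U|^{10/3}|y|^{-5/3} ≤ R^{-5/3} K² (∫_{|y|≤4R}|U|²)^{2/3} (2∫_{R/2≤|y|≤4R}|DU|² + 2(5C₀/2R)² ∫|U|²)`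
`≤ K₁ ∫_{R/2 ≤ |y| < 8R} |DU|² min(1,|y|⁻¹) + K₂ R⁻²` (`setLIntegral_shell_rpow_ten_thirds_le`),
and the shells are summed (`setLIntegral_lt_top_of_dyadic`: each point lies in at most four of
the enlarged annuli, `Σ 4⁻ᵏ = 4/3`); the ball `B_{R₁}` contributes
`sup |U|^{10/3} ∫_{B_{R₁}} |y|^{-5/3} < ∞` (`5/3 < 3`).

## Mathlib / tree search

Mathlib: `exists_nat_pow_near`, `lintegral_iUnion`, `lintegral_iUnion_le`, `tsum_eq_zero_add'`,
`ENNReal.tsum_geometric`, `integrableOn_ball_of_norm_le_rpow`, `eLpNorm_eq_lintegral_rpow_enorm_toReal`,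
`Real.sum_mul_le_sqrt_mul_sqrt`, `OrthonormalBasis.sum_sq_inner_right` (all used). Tree:
`eLpNorm_ten_thirds_le_of_contDiff_euclidean` (`MultiplicativeInequality`), `cutoff`,
`exists_norm_fderiv_cutoff_le` (`WholeSpaceIBP`); the op-norm/Frobenius comparison exists as
`sq_opNorm_le_frobeniusNormSq` in `TaoEnstrophyLocalisationProofs` behind much heavier imports
and is re-proved here (`opNorm_sq_le_frobeniusNormSq_fin3`).

## References

* T.-P. Tsai, *On Leray's self-similar solutions of the Navier–Stokes equations satisfying local
  energy estimates*, Arch. Rational Mech. Anal. 143 (1998) 29–51: §4, (4.1)–(4.3), pp. 44–45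
  [Tsai1998].
* L. Caffarelli, R. Kohn, L. Nirenberg, *Partial regularity of suitable weak solutions of the
  Navier–Stokes equations*, Comm. Pure Appl. Math. 35 (1982), p. 781 (the interpolation
  `L^∞L² ∩ L²H¹ ⊂ L^{10/3}`) [CaffarelliKohnNirenberg1982].
* L. Escauriaza, G. Seregin, V. Šverák, *`L_{3,∞}`-solutions of Navier–Stokes equations and
  backward uniqueness*, Russ. Math. Surveys 58 (2003), (3.7) [EscauriazaSereginSverak2003].
-/

noncomputable section

open MeasureTheory Set Function Filter Topology Metric
open scoped ENNReal NNReal RealInnerProductSpace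

namespace Literature.Analysis.FluidPDE

/-! ### Dyadic shells -/

section Dyadic

variable {R₁ : ℝ}

/-- Membership in the dyadic shell `{R₁2ᵏ ≤ |y| < R₁2^{k+1}}` is measurable. [folklore] -/
theorem measurableSet_dyadicShell (R₁ : ℝ) (k : ℕ) :
    MeasurableSet {y : (EuclideanSpace ℝ (Fin 3)) | R₁ * 2 ^ k ≤ ‖y‖ ∧ ‖y‖ < R₁ * 2 ^ (k + 1)} :=
  (measurableSet_le measurable_const measurable_norm).inter
    (measurableSet_lt measurable_norm measurable_const)

/-- The dyadic shells `{R₁2ᵏ ≤ |y| < R₁2^{k+1}}`, `k ∈ ℕ`, are pairwise disjoint (`R₁ > 0`). [folklore] -/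
theorem pairwise_disjoint_dyadicShell (hR₁ : 0 < R₁) :
    Pairwise (Disjoint on fun k : ℕ => {y : (EuclideanSpace ℝ (Fin 3)) | R₁ * 2 ^ k ≤ ‖y‖ ∧ ‖y‖ < R₁ * 2 ^ (k + 1)}) := by
  intro j k hjk
  rw [Function.onFun, Set.disjoint_left]
  rintro y ⟨hj1, hj2⟩ ⟨hk1, hk2⟩
  rcases lt_or_gt_of_ne hjk with h | h
  · have : R₁ * 2 ^ (j + 1) ≤ R₁ * 2 ^ k :=
      mul_le_mul_of_nonneg_left (pow_le_pow_right₀ one_le_two (by omega)) hR₁.le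
    linarith
  · have : R₁ * 2 ^ (k + 1) ≤ R₁ * 2 ^ j :=
      mul_le_mul_of_nonneg_left (pow_le_pow_right₀ one_le_two (by omega)) hR₁.le
    linarith

/-- Every `y` with `|y| ≥ R₁ > 0` lies in some dyadic shell `{R₁2ᵏ ≤ |y| < R₁2^{k+1}}`
(Mathlib `exists_nat_pow_near`). [folklore] -/
theorem exists_mem_dyadicShell (hR₁ : 0 < R₁) {y : (EuclideanSpace ℝ (Fin 3))} (hy : R₁ ≤ ‖y‖) :
    ∃ k : ℕ, R₁ * 2 ^ k ≤ ‖y‖ ∧ ‖y‖ < R₁ * 2 ^ (k + 1) := by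
  obtain ⟨n, hn1, hn2⟩ := exists_nat_pow_near ((one_le_div hR₁).2 hy) one_lt_two
  refine ⟨n, ?_, ?_⟩
  · rwa [le_div_iff₀ hR₁, mul_comm] at hn1
  · rwa [div_lt_iff₀ hR₁, mul_comm] at hn2

/-- The region `{|y| ≥ R₁}` is the disjoint union of the dyadic shells. [folklore] -/
theorem iUnion_dyadicShell (hR₁ : 0 < R₁) :
    (⋃ k : ℕ, {y : (EuclideanSpace ℝ (Fin 3)) | R₁ * 2 ^ k ≤ ‖y‖ ∧ ‖y‖ < R₁ * 2 ^ (k + 1)}) = {y : (EuclideanSpace ℝ (Fin 3)) | R₁ ≤ ‖y‖} := by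
  ext y
  simp only [mem_iUnion, mem_setOf_eq]
  constructor
  · rintro ⟨k, hk1, -⟩
    exact le_trans (le_mul_of_one_le_right hR₁.le (one_le_pow₀ one_le_two)) hk1
  · exact fun hy => exists_mem_dyadicShell hR₁ hy

/-- The enlarged annulus `{R₁2ᵏ/2 ≤ |y| < R₁2^{k+3}}` is covered by the four half-size shells
`{R₁2^{k+i}/2 ≤ |y| < R₁2^{k+i}}`, `i < 4`. [folklore] -/
theorem annulus_subset_iUnion_halfShell (hR₁ : 0 < R₁) (k : ℕ) :
    {y : (EuclideanSpace ℝ (Fin 3)) | R₁ * 2 ^ k / 2 ≤ ‖y‖ ∧ ‖y‖ < R₁ * 2 ^ (k + 3)} ⊆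
      ⋃ i : Fin 4, {y : (EuclideanSpace ℝ (Fin 3)) | R₁ * 2 ^ (k + i) / 2 ≤ ‖y‖ ∧ ‖y‖ < R₁ * 2 ^ (k + i)} := by
  rintro y ⟨hy1, hy2⟩
  have hb : 0 < R₁ * 2 ^ k / 2 := by positivity
  obtain ⟨n, hn1, hn2⟩ := exists_nat_pow_near ((one_le_div hb).2 hy1) one_lt_two
  have hn : n < 4 := by
    by_contra h
    push Not at h
    have h16 : (2 : ℝ) ^ 4 ≤ 2 ^ n := pow_le_pow_right₀ one_le_two h
    have : R₁ * 2 ^ (k + 3) ≤ ‖y‖ := by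
      rw [le_div_iff₀ hb] at hn1
      calc R₁ * 2 ^ (k + 3) = 2 ^ 4 * (R₁ * 2 ^ k / 2) := by ring
        _ ≤ 2 ^ n * (R₁ * 2 ^ k / 2) := mul_le_mul_of_nonneg_right h16 hb.le
        _ ≤ ‖y‖ := hn1
    linarith
  refine mem_iUnion.2 ⟨⟨n, hn⟩, ?_, ?_⟩
  · rw [le_div_iff₀ hb] at hn1
    calc R₁ * 2 ^ (k + (⟨n, hn⟩ : Fin 4)) / 2 = 2 ^ n * (R₁ * 2 ^ k / 2) := by
          simp only [pow_add]; ring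
      _ ≤ ‖y‖ := hn1
  · rw [div_lt_iff₀ hb] at hn2
    calc ‖y‖ < 2 ^ (n + 1) * (R₁ * 2 ^ k / 2) := hn2
      _ = R₁ * 2 ^ (k + (⟨n, hn⟩ : Fin 4)) := by simp only [pow_add, pow_one]; ring

/-- **Dyadic summation.** Let `g, h ≥ 0` on `ℝ³`, `R₁ > 0`, and constants `K₁, K₂ < ∞` such that
on every dyadic shell `Sₖ = {R₁2ᵏ ≤ |y| < R₁2^{k+1}}`,
`∫_{Sₖ} g ≤ K₁ ∫_{R₁2ᵏ/2 ≤ |y| < R₁2^{k+3}} h + K₂ 4⁻ᵏ`. If `∫ h < ∞` then `∫_{|y| ≥ R₁} g < ∞`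
(each point of the enlarged annuli lies in at most four half-size shells, and `Σ 4⁻ᵏ = 4/3`). [folklore] -/
theorem setLIntegral_lt_top_of_dyadic (hR₁ : 0 < R₁) {g h : (EuclideanSpace ℝ (Fin 3)) → ℝ≥0∞} {K₁ K₂ : ℝ≥0∞}
    (hK₁ : K₁ ≠ ∞) (hK₂ : K₂ ≠ ∞) (hh : ∫⁻ y, h y < ∞)
    (hshell : ∀ k : ℕ, ∫⁻ y in {y : (EuclideanSpace ℝ (Fin 3)) | R₁ * 2 ^ k ≤ ‖y‖ ∧ ‖y‖ < R₁ * 2 ^ (k + 1)}, g y ≤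
      K₁ * (∫⁻ y in {y : (EuclideanSpace ℝ (Fin 3)) | R₁ * 2 ^ k / 2 ≤ ‖y‖ ∧ ‖y‖ < R₁ * 2 ^ (k + 3)}, h y) +
        K₂ * (4⁻¹ : ℝ≥0∞) ^ k) :
    ∫⁻ y in {y : (EuclideanSpace ℝ (Fin 3)) | R₁ ≤ ‖y‖}, g y < ∞ := by
  -- the half-size shells `B j = {R₁2ʲ/2 ≤ |y| < R₁2ʲ}` are disjoint
  set B : ℕ → Set (EuclideanSpace ℝ (Fin 3)) := fun j => {y : (EuclideanSpace ℝ (Fin 3)) | R₁ * 2 ^ j / 2 ≤ ‖y‖ ∧ ‖y‖ < R₁ * 2 ^ j} with hB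
  have hBm : ∀ j, MeasurableSet (B j) := fun j =>
    (measurableSet_le measurable_const measurable_norm).inter
      (measurableSet_lt measurable_norm measurable_const)
  have hBeq : ∀ j, B j = {y : (EuclideanSpace ℝ (Fin 3)) | R₁ / 2 * 2 ^ j ≤ ‖y‖ ∧ ‖y‖ < R₁ / 2 * 2 ^ (j + 1)} := by
    intro j; ext y
    simp only [hB, mem_setOf_eq, pow_succ]
    constructor <;> rintro ⟨h1, h2⟩ <;> constructor <;> nlinarith
  have hBdisj : Pairwise (Disjoint on B) := by
    have := pairwise_disjoint_dyadicShell (R₁ := R₁ / 2) (by positivity)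
    intro i j hij
    have h := this hij
    simp only [Function.onFun] at h ⊢
    rwa [hBeq i, hBeq j]
  have hsumB : ∑' j, ∫⁻ y in B j, h y ≤ ∫⁻ y, h y := by
    rw [← lintegral_iUnion hBm hBdisj]
    exact setLIntegral_le_lintegral _ _
  -- the annulus integral is at most the sum over four consecutive half-shells
  have hann : ∀ k : ℕ, ∫⁻ y in {y : (EuclideanSpace ℝ (Fin 3)) | R₁ * 2 ^ k / 2 ≤ ‖y‖ ∧ ‖y‖ < R₁ * 2 ^ (k + 3)}, h y ≤
      ∑ i : Fin 4, ∫⁻ y in B (k + i), h y := by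
    intro k
    calc ∫⁻ y in {y : (EuclideanSpace ℝ (Fin 3)) | R₁ * 2 ^ k / 2 ≤ ‖y‖ ∧ ‖y‖ < R₁ * 2 ^ (k + 3)}, h y
        ≤ ∫⁻ y in ⋃ i : Fin 4, B (k + i), h y :=
          lintegral_mono_set (annulus_subset_iUnion_halfShell hR₁ k)
      _ ≤ ∑' i : Fin 4, ∫⁻ y in B (k + i), h y := lintegral_iUnion_le _ _
      _ = ∑ i : Fin 4, ∫⁻ y in B (k + i), h y := tsum_fintype _
  -- shifted sums are bounded by the full sum
  set f : ℕ → ℝ≥0∞ := fun j => ∫⁻ y in B j, h y with hf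
  have hshift : ∀ i : ℕ, ∑' k, f (k + i) ≤ ∑' j, f j := by
    intro i
    induction i with
    | zero => simp
    | succ n ih =>
        have e : (fun k => f (k + (n + 1))) = fun k => (fun m => f (m + n)) (k + 1) := by
          funext k; simp only [add_assoc, add_comm n 1]
        calc ∑' k, f (k + (n + 1)) = ∑' k, (fun m => f (m + n)) (k + 1) := by rw [e]
          _ ≤ (fun m => f (m + n)) 0 + ∑' k, (fun m => f (m + n)) (k + 1) := le_add_self
          _ = ∑' m, f (m + n) := (tsum_eq_zero_add' (f := fun m => f (m + n)) ENNReal.summable).symm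
          _ ≤ _ := ih
  have h4 : ∀ k : ℕ, ∫⁻ y in {y : (EuclideanSpace ℝ (Fin 3)) | R₁ * 2 ^ k / 2 ≤ ‖y‖ ∧ ‖y‖ < R₁ * 2 ^ (k + 3)}, h y ≤
      f (k + 0) + f (k + 1) + f (k + 2) + f (k + 3) := by
    intro k
    refine (hann k).trans_eq ?_
    simp only [Fin.sum_univ_four, hf]
    norm_num
  -- sum the shell estimates
  have hgeom : ∑' k : ℕ, (4⁻¹ : ℝ≥0∞) ^ k = (1 - 4⁻¹)⁻¹ := ENNReal.tsum_geometric _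
  have hgeom_fin : (1 - 4⁻¹ : ℝ≥0∞)⁻¹ ≠ ∞ := by
    refine ENNReal.inv_ne_top.2 (ne_of_gt (tsub_pos_iff_lt.2 ?_))
    exact ENNReal.inv_lt_one.2 (by norm_num)
  rw [← iUnion_dyadicShell hR₁, lintegral_iUnion (measurableSet_dyadicShell R₁)
    (pairwise_disjoint_dyadicShell hR₁)]
  have hI : ∀ i : ℕ, ∑' k, f (k + i) ≤ ∫⁻ y, h y := fun i => (hshift i).trans hsumB
  have hsum4 : (∫⁻ y, h y) + (∫⁻ y, h y) + (∫⁻ y, h y) + (∫⁻ y, h y) < ∞ :=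
    ENNReal.add_lt_top.2 ⟨ENNReal.add_lt_top.2 ⟨ENNReal.add_lt_top.2 ⟨hh, hh⟩, hh⟩, hh⟩
  calc ∑' k, ∫⁻ y in {y : (EuclideanSpace ℝ (Fin 3)) | R₁ * 2 ^ k ≤ ‖y‖ ∧ ‖y‖ < R₁ * 2 ^ (k + 1)}, g y
      ≤ ∑' k, (K₁ * (f (k + 0) + f (k + 1) + f (k + 2) + f (k + 3)) + K₂ * (4⁻¹ : ℝ≥0∞) ^ k) :=
        ENNReal.tsum_le_tsum fun k => (hshell k).trans (add_le_add (mul_le_mul_right (h4 k) _) le_rfl)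
    _ = K₁ * (∑' k, f (k + 0) + ∑' k, f (k + 1) + ∑' k, f (k + 2) + ∑' k, f (k + 3)) +
          K₂ * (1 - 4⁻¹)⁻¹ := by
        rw [ENNReal.tsum_add, ENNReal.tsum_mul_left, ENNReal.tsum_mul_left, hgeom, ENNReal.tsum_add,
          ENNReal.tsum_add, ENNReal.tsum_add]
    _ ≤ K₁ * ((∫⁻ y, h y) + (∫⁻ y, h y) + (∫⁻ y, h y) + (∫⁻ y, h y)) + K₂ * (1 - 4⁻¹)⁻¹ :=
        add_le_add (mul_le_mul_right (add_le_add (add_le_add (add_le_add (hI 0) (hI 1)) (hI 2))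
          (hI 3)) _) le_rfl
    _ < ∞ := ENNReal.add_lt_top.2 ⟨ENNReal.mul_lt_top hK₁.lt_top hsum4,
        ENNReal.mul_lt_top hK₂.lt_top hgeom_fin.lt_top⟩

end Dyadic

/-! ### The annular cut-off `η_R = χ_{2R} − χ_{R/2}` -/

section Cutoff

variable {R : ℝ}

/-- `η_R = 1` on the shell `R ≤ |y| ≤ 2R`. [folklore] -/
theorem annularCutoff_eq_one (hR : 0 < R) {y : (EuclideanSpace ℝ (Fin 3))} (h1 : R ≤ ‖y‖) (h2 : ‖y‖ ≤ 2 * R) :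
    cutoff (2 * R) y - cutoff (R / 2) y = 1 := by
  rw [cutoff_eq_one (by positivity) h2, cutoff_eq_zero (by positivity) (by linarith)]
  norm_num

/-- `|η_R| ≤ 1` everywhere. [folklore] -/
theorem abs_annularCutoff_le_one (R : ℝ) (y : (EuclideanSpace ℝ (Fin 3))) : |cutoff (2 * R) y - cutoff (R / 2) y| ≤ 1 := by
  rw [abs_sub_le_iff]
  constructor <;> linarith [cutoff_nonneg (2 * R) y, cutoff_le_one (2 * R) y,
    cutoff_nonneg (R / 2) y, cutoff_le_one (R / 2) y]

/-- `η_R = 0` off the closed annulus `R/2 ≤ |y| ≤ 4R`. [folklore] -/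
theorem annularCutoff_eq_zero (hR : 0 < R) {y : (EuclideanSpace ℝ (Fin 3))} (h : ‖y‖ < R / 2 ∨ 4 * R < ‖y‖) :
    cutoff (2 * R) y - cutoff (R / 2) y = 0 := by
  rcases h with h | h
  · rw [cutoff_eq_one (by positivity) (by linarith), cutoff_eq_one (by positivity) h.le, sub_self]
  · rw [cutoff_eq_zero (by positivity) (by linarith), cutoff_eq_zero (by positivity) (by linarith),
      sub_self]

/-- `η_R` is smooth. [folklore] -/
theorem contDiff_annularCutoff (R : ℝ) {n : ℕ∞} :
    ContDiff ℝ n fun y : (EuclideanSpace ℝ (Fin 3)) => cutoff (2 * R) y - cutoff (R / 2) y :=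
  (contDiff_cutoff _).sub (contDiff_cutoff _)

/-- `η_R` has compact support (inside `B̄_{4R}`). [folklore] -/
theorem hasCompactSupport_annularCutoff (hR : 0 < R) :
    HasCompactSupport fun y : (EuclideanSpace ℝ (Fin 3)) => cutoff (2 * R) y - cutoff (R / 2) y := by
  refine HasCompactSupport.intro (isCompact_closedBall (0 : (EuclideanSpace ℝ (Fin 3))) (4 * R)) fun y hy => ?_
  rw [mem_closedBall_zero_iff, not_le] at hy
  exact annularCutoff_eq_zero hR (Or.inr hy)

/-- **Gradient bound for the annular cut-off**: with `C₀` the constant of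
`exists_norm_fderiv_cutoff_le` (`‖Dχ_r‖ ≤ C₀/r`), `‖Dη_R(y)‖ ≤ (5C₀/2)/R` on the annulus
`R/2 ≤ |y| ≤ 4R` and `Dη_R(y) = 0` off it. [folklore] -/
theorem norm_fderiv_annularCutoff_le (hR : 0 < R) {C₀ : ℝ}
    (hC : ∀ r : ℝ, 0 < r → ∀ x : (EuclideanSpace ℝ (Fin 3)), ‖fderiv ℝ (cutoff r) x‖ ≤ C₀ / r) (y : (EuclideanSpace ℝ (Fin 3))) :
    ‖fderiv ℝ (fun y : (EuclideanSpace ℝ (Fin 3)) => cutoff (2 * R) y - cutoff (R / 2) y) y‖ ≤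
      {y : (EuclideanSpace ℝ (Fin 3)) | R / 2 ≤ ‖y‖ ∧ ‖y‖ ≤ 4 * R}.indicator (fun _ => 5 * C₀ / 2 / R) y := by
  by_cases hy : y ∈ {y : (EuclideanSpace ℝ (Fin 3)) | R / 2 ≤ ‖y‖ ∧ ‖y‖ ≤ 4 * R}
  · rw [indicator_of_mem hy]
    have hd1 : DifferentiableAt ℝ (cutoff (2 * R)) y := (contDiff_cutoff (n := 1) _).differentiable
      one_ne_zero y
    have hd2 : DifferentiableAt ℝ (cutoff (R / 2)) y := (contDiff_cutoff (n := 1) _).differentiable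
      one_ne_zero y
    rw [fderiv_fun_sub hd1 hd2]
    calc ‖fderiv ℝ (cutoff (2 * R)) y - fderiv ℝ (cutoff (R / 2)) y‖
        ≤ ‖fderiv ℝ (cutoff (2 * R)) y‖ + ‖fderiv ℝ (cutoff (R / 2)) y‖ := norm_sub_le _ _
      _ ≤ C₀ / (2 * R) + C₀ / (R / 2) := add_le_add (hC _ (by positivity) y) (hC _ (by positivity) y)
      _ = 5 * C₀ / 2 / R := by field_simp; ring
  · rw [indicator_of_notMem hy]
    have hy' : ‖y‖ < R / 2 ∨ 4 * R < ‖y‖ := by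
      simp only [mem_setOf_eq, not_and_or, not_le] at hy
      exact hy
    -- `η_R` vanishes on a neighbourhood of `y`
    have hev : (fun y : (EuclideanSpace ℝ (Fin 3)) => cutoff (2 * R) y - cutoff (R / 2) y) =ᶠ[𝓝 y] fun _ => 0 := by
      rcases hy' with h | h
      · filter_upwards [(isOpen_lt continuous_norm continuous_const).mem_nhds h] with z hz
        exact annularCutoff_eq_zero hR (Or.inl hz)
      · filter_upwards [(isOpen_lt continuous_const continuous_norm).mem_nhds h] with z hz
        exact annularCutoff_eq_zero hR (Or.inr hz)
    rw [hev.fderiv_eq, fderiv_const_apply, norm_zero]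

end Cutoff

/-! ### One shell: the multiplicative inequality applied to `η U` -/

section Shell

/-- The operator norm is dominated by the Frobenius norm: `‖L‖² ≤ Σᵢ ‖L eᵢ‖²`
(Cauchy–Schwarz in an orthonormal expansion). [folklore] -/
theorem opNorm_sq_le_frobeniusNormSq_fin3 (L : (EuclideanSpace ℝ (Fin 3)) →L[ℝ] (EuclideanSpace ℝ (Fin 3))) : ‖L‖ ^ 2 ≤ frobeniusNormSq L := by
  set b := stdOrthonormalBasis ℝ (EuclideanSpace ℝ (Fin 3))
  have hfrob : frobeniusNormSq L = ∑ i, ‖L (b i)‖ ^ 2 := rfl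
  have hle : ‖L‖ ≤ Real.sqrt (frobeniusNormSq L) := by
    refine ContinuousLinearMap.opNorm_le_bound _ (Real.sqrt_nonneg _) fun v => ?_
    have hv : L v = ∑ i, ⟪b i, v⟫ • L (b i) := by
      conv_lhs => rw [← b.sum_repr' v]
      simp [map_sum, map_smul]
    calc ‖L v‖ = ‖∑ i, ⟪b i, v⟫ • L (b i)‖ := by rw [hv]
      _ ≤ ∑ i, ‖⟪b i, v⟫ • L (b i)‖ := norm_sum_le _ _
      _ = ∑ i, |⟪b i, v⟫| * ‖L (b i)‖ := by simp [norm_smul]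
      _ ≤ Real.sqrt (∑ i, |⟪b i, v⟫| ^ 2) * Real.sqrt (∑ i, ‖L (b i)‖ ^ 2) :=
          Real.sum_mul_le_sqrt_mul_sqrt _ _ _
      _ = Real.sqrt (frobeniusNormSq L) * ‖v‖ := by
          rw [hfrob, mul_comm]
          congr 1
          simp_rw [sq_abs]
          rw [b.sum_sq_inner_right, Real.sqrt_sq (norm_nonneg _)]
  calc ‖L‖ ^ 2 ≤ (Real.sqrt (frobeniusNormSq L)) ^ 2 := pow_le_pow_left₀ (norm_nonneg _) hle 2
    _ = frobeniusNormSq L := Real.sq_sqrt (frobeniusNormSq_nonneg _)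

/-- **The multiplicative inequality on one shell.** Let `U ∈ C¹(ℝ³; ℝ³)`, `η ∈ C¹_c(ℝ³)` with
`|η| ≤ 𝟙_S` and `‖Dη‖ ≤ d 𝟙_S` for a measurable set `S`. Then, with `K` the
Gagliardo–Nirenberg–Sobolev constant of `ℝ³`,
`∫ |ηU|^{10/3} ≤ K² (∫_S |U|²)^{2/3} (2 ∫_S |DU|² + 2 d² ∫_S |U|²)`
(`‖ηU‖_{10/3} ≤ K^{3/5} ‖ηU‖₂^{2/5} ‖D(ηU)‖₂^{3/5}` from `MultiplicativeInequality`, raised to the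
power `10/3`, with `D(ηU) = η DU + Dη ⊗ U` and `‖DU‖_{op}² ≤ |DU|²`; the step behind Tsai 1998,
(4.3), on a dyadic shell). [cite: Tsai1998, (4.1)–(4.3) pp. 44–45] -/
theorem lintegral_cutoff_mul_rpow_ten_thirds_le {U : (EuclideanSpace ℝ (Fin 3)) → (EuclideanSpace ℝ (Fin 3))} (hU : ContDiff ℝ 1 U) {η : (EuclideanSpace ℝ (Fin 3)) → ℝ}
    (hη : ContDiff ℝ 1 η) (hηc : HasCompactSupport η) {S : Set (EuclideanSpace ℝ (Fin 3))} (hS : MeasurableSet S) {d : ℝ}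
    (hη1 : ∀ y, |η y| ≤ S.indicator (fun _ => (1 : ℝ)) y)
    (hDη : ∀ y, ‖fderiv ℝ η y‖ ≤ S.indicator (fun _ => d) y) :
    ∫⁻ y, ‖η y • U y‖ₑ ^ (10 / 3 : ℝ) ≤
      (SNormLESNormFDerivOfEqConst (EuclideanSpace ℝ (Fin 3)) (volume : Measure (EuclideanSpace ℝ (Fin 3))) 2 : ℝ≥0∞) ^ 2 *
        (∫⁻ y in S, ‖U y‖ₑ ^ 2) ^ (2 / 3 : ℝ) *
        (2 * (∫⁻ y in S, ENNReal.ofReal (frobeniusNormSq (fderiv ℝ U y))) +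
          2 * ENNReal.ofReal (d ^ 2) * ∫⁻ y in S, ‖U y‖ₑ ^ 2) := by
  set K : ℝ≥0∞ := (SNormLESNormFDerivOfEqConst (EuclideanSpace ℝ (Fin 3)) (volume : Measure (EuclideanSpace ℝ (Fin 3))) 2 : ℝ≥0∞) with hK
  set V : (EuclideanSpace ℝ (Fin 3)) → (EuclideanSpace ℝ (Fin 3)) := fun y => η y • U y with hV
  have hV1 : ContDiff ℝ 1 V := hη.smul hU
  have hVc : HasCompactSupport V := hηc.smul_right
  have hV2 : eLpNorm V 2 volume < ∞ := (hV1.continuous.memLp_of_hasCompactSupport hVc).eLpNorm_lt_top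
  have hGN := eLpNorm_ten_thirds_le_of_contDiff_euclidean hV1 hV2
  -- (a) in terms of lower Lebesgue integrals
  set A : ℝ≥0∞ := ∫⁻ y, ‖V y‖ₑ ^ (2 : ℝ) with hA
  set B : ℝ≥0∞ := ∫⁻ y, ‖fderiv ℝ V y‖ₑ ^ (2 : ℝ) with hB
  have h103 : (10 / 3 : ℝ≥0∞) = ((10 / 3 : ℝ≥0) : ℝ≥0∞) := by
    rw [ENNReal.coe_div (by norm_num)]; norm_num
  have e103 : eLpNorm V (10 / 3) volume = (∫⁻ y, ‖V y‖ₑ ^ (10 / 3 : ℝ)) ^ (3 / 10 : ℝ) := by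
    rw [h103, eLpNorm_nnreal_eq_lintegral (by norm_num)]
    norm_num
  have e2 : ∀ f : (EuclideanSpace ℝ (Fin 3)) → ((EuclideanSpace ℝ (Fin 3)) →L[ℝ] (EuclideanSpace ℝ (Fin 3))), eLpNorm f 2 volume = (∫⁻ y, ‖f y‖ₑ ^ (2 : ℝ)) ^ (1 / 2 : ℝ) := by
    intro f
    rw [eLpNorm_eq_lintegral_rpow_enorm_toReal two_ne_zero ENNReal.ofNat_ne_top, ENNReal.toReal_ofNat]
  have e2' : eLpNorm V 2 volume = A ^ (1 / 2 : ℝ) := by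
    rw [eLpNorm_eq_lintegral_rpow_enorm_toReal two_ne_zero ENNReal.ofNat_ne_top, ENNReal.toReal_ofNat]
  rw [e103, e2', e2, ← hB, ← ENNReal.rpow_mul, ← ENNReal.rpow_mul] at hGN
  have hmain : ∫⁻ y, ‖V y‖ₑ ^ (10 / 3 : ℝ) ≤ K ^ 2 * A ^ (2 / 3 : ℝ) * B := by
    have h := ENNReal.rpow_le_rpow hGN (by norm_num : (0 : ℝ) ≤ 10 / 3)
    rw [← ENNReal.rpow_mul, ENNReal.mul_rpow_of_nonneg _ _ (by norm_num),
      ENNReal.mul_rpow_of_nonneg _ _ (by norm_num), ← ENNReal.rpow_mul, ← ENNReal.rpow_mul,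
      ← ENNReal.rpow_mul] at h
    norm_num at h
    exact h
  -- (b) `∫ |V|² ≤ ∫_S |U|²`
  have hVle : ∀ y, ‖V y‖ₑ ≤ S.indicator (fun y => ‖U y‖ₑ) y := by
    intro y
    simp only [hV, enorm_smul]
    by_cases hy : y ∈ S
    · rw [indicator_of_mem hy]
      have h1 : ‖η y‖ₑ ≤ 1 := by
        rw [← ofReal_norm, Real.norm_eq_abs, ← ENNReal.ofReal_one]
        exact ENNReal.ofReal_le_ofReal ((hη1 y).trans_eq (indicator_of_mem hy _))
      calc ‖η y‖ₑ * ‖U y‖ₑ ≤ 1 * ‖U y‖ₑ := mul_le_mul' h1 le_rfl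
        _ = ‖U y‖ₑ := one_mul _
    · rw [indicator_of_notMem hy]
      have h0 : η y = 0 := by
        have := hη1 y
        rw [indicator_of_notMem hy] at this
        exact abs_nonpos_iff.1 this
      simp [h0]
  have hAle : A ≤ ∫⁻ y in S, ‖U y‖ₑ ^ 2 := by
    rw [hA, ← lintegral_indicator hS]
    refine lintegral_mono fun y => ?_
    rw [ENNReal.rpow_two]
    calc ‖V y‖ₑ ^ 2 ≤ (S.indicator (fun y => ‖U y‖ₑ) y) ^ 2 := pow_le_pow_left' (hVle y) 2
      _ = S.indicator (fun y => ‖U y‖ₑ ^ 2) y := by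
          by_cases hy : y ∈ S <;> simp [hy]
  -- (c) `∫ |DV|² ≤ 2 ∫_S |DU|² + 2 d² ∫_S |U|²`
  have hDVle : ∀ y, ‖fderiv ℝ V y‖ₑ ^ (2 : ℝ) ≤ S.indicator (fun y => 2 *
      (ENNReal.ofReal (frobeniusNormSq (fderiv ℝ U y)) + ENNReal.ofReal (d ^ 2) * ‖U y‖ₑ ^ 2)) y := by
    intro y
    have hηd : DifferentiableAt ℝ η y := hη.differentiable one_ne_zero y
    have hUd : DifferentiableAt ℝ U y := hU.differentiable one_ne_zero y
    have hDV : fderiv ℝ V y = η y • fderiv ℝ U y + (fderiv ℝ η y).smulRight (U y) :=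
      fderiv_fun_smul hηd hUd
    by_cases hy : y ∈ S
    · rw [indicator_of_mem hy]
      have hn : ‖fderiv ℝ V y‖ ≤ ‖fderiv ℝ U y‖ + d * ‖U y‖ := by
        rw [hDV]
        calc ‖η y • fderiv ℝ U y + (fderiv ℝ η y).smulRight (U y)‖
            ≤ ‖η y • fderiv ℝ U y‖ + ‖(fderiv ℝ η y).smulRight (U y)‖ := norm_add_le _ _
          _ = |η y| * ‖fderiv ℝ U y‖ + ‖fderiv ℝ η y‖ * ‖U y‖ := by
              rw [norm_smul, Real.norm_eq_abs, ContinuousLinearMap.norm_smulRight_apply]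
          _ ≤ 1 * ‖fderiv ℝ U y‖ + d * ‖U y‖ := by
              gcongr
              · exact (hη1 y).trans_eq (indicator_of_mem hy _)
              · exact (hDη y).trans_eq (indicator_of_mem hy _)
          _ = ‖fderiv ℝ U y‖ + d * ‖U y‖ := by rw [one_mul]
      have hsq : ‖fderiv ℝ V y‖ ^ 2 ≤ 2 * (frobeniusNormSq (fderiv ℝ U y) + d ^ 2 * ‖U y‖ ^ 2) := by
        have h1 : ‖fderiv ℝ V y‖ ^ 2 ≤ (‖fderiv ℝ U y‖ + d * ‖U y‖) ^ 2 :=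
          pow_le_pow_left₀ (norm_nonneg _) hn 2
        have h2 : (‖fderiv ℝ U y‖ + d * ‖U y‖) ^ 2 ≤ 2 * (‖fderiv ℝ U y‖ ^ 2 + (d * ‖U y‖) ^ 2) := by
          nlinarith [sq_nonneg (‖fderiv ℝ U y‖ - d * ‖U y‖)]
        have h3 := opNorm_sq_le_frobeniusNormSq_fin3 (fderiv ℝ U y)
        nlinarith [h1, h2, h3, sq_nonneg (d * ‖U y‖)]
      have hR : (2 : ℝ≥0∞) * (ENNReal.ofReal (frobeniusNormSq (fderiv ℝ U y)) +
          ENNReal.ofReal (d ^ 2) * ‖U y‖ₑ ^ 2) =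
          ENNReal.ofReal (2 * (frobeniusNormSq (fderiv ℝ U y) + d ^ 2 * ‖U y‖ ^ 2)) := by
        rw [ENNReal.ofReal_mul (by norm_num : (0 : ℝ) ≤ 2), ENNReal.ofReal_ofNat,
          ENNReal.ofReal_add (frobeniusNormSq_nonneg _) (by positivity),
          ENNReal.ofReal_mul (sq_nonneg _), ENNReal.ofReal_pow (norm_nonneg _), ofReal_norm]
      rw [hR, ENNReal.rpow_two, ← ofReal_norm, ← ENNReal.ofReal_pow (norm_nonneg _)]
      exact ENNReal.ofReal_le_ofReal hsq
    · rw [indicator_of_notMem hy]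
      have h0 : η y = 0 := by
        have := hη1 y
        rw [indicator_of_notMem hy] at this
        exact abs_nonpos_iff.1 this
      have hD0 : fderiv ℝ η y = 0 := by
        have := hDη y
        rw [indicator_of_notMem hy] at this
        exact norm_le_zero_iff.1 this
      have hV0 : fderiv ℝ V y = 0 := by
        rw [hDV, h0, hD0, zero_smul ℝ (fderiv ℝ U y), ContinuousLinearMap.zero_smulRight, add_zero]
      have hV0' : ‖fderiv ℝ V y‖ₑ = 0 := by
        rw [← ofReal_norm, hV0, ContinuousLinearMap.opNorm_zero, ENNReal.ofReal_zero]
      rw [hV0', ENNReal.zero_rpow_of_pos (by norm_num)]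
  have hFm : Measurable fun y : (EuclideanSpace ℝ (Fin 3)) => ENNReal.ofReal (frobeniusNormSq (fderiv ℝ U y)) := by
    have hfrob : Continuous (frobeniusNormSq : ((EuclideanSpace ℝ (Fin 3)) →L[ℝ] (EuclideanSpace ℝ (Fin 3))) → ℝ) := by
      unfold frobeniusNormSq
      exact continuous_finsetSum _ fun i _ =>
        ((ContinuousLinearMap.apply ℝ (EuclideanSpace ℝ (Fin 3)) (stdOrthonormalBasis ℝ (EuclideanSpace ℝ (Fin 3)) i)).continuous.norm).pow 2
    exact (hfrob.comp (hU.continuous_fderiv one_ne_zero)).measurable.ennreal_ofReal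
  have hBle : B ≤ 2 * (∫⁻ y in S, ENNReal.ofReal (frobeniusNormSq (fderiv ℝ U y))) +
      2 * ENNReal.ofReal (d ^ 2) * ∫⁻ y in S, ‖U y‖ₑ ^ 2 := by
    calc B ≤ ∫⁻ y, S.indicator (fun y => 2 * (ENNReal.ofReal (frobeniusNormSq (fderiv ℝ U y)) +
          ENNReal.ofReal (d ^ 2) * ‖U y‖ₑ ^ 2)) y := lintegral_mono hDVle
      _ = 2 * (∫⁻ y in S, ENNReal.ofReal (frobeniusNormSq (fderiv ℝ U y))) +
          2 * ENNReal.ofReal (d ^ 2) * ∫⁻ y in S, ‖U y‖ₑ ^ 2 := by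
          rw [lintegral_indicator hS, lintegral_const_mul' _ _ (by norm_num), lintegral_add_left
            hFm, lintegral_const_mul' _ _ ENNReal.ofReal_ne_top, mul_add, mul_assoc]
  -- (d) combine
  calc ∫⁻ y, ‖V y‖ₑ ^ (10 / 3 : ℝ) ≤ K ^ 2 * A ^ (2 / 3 : ℝ) * B := hmain
    _ ≤ K ^ 2 * (∫⁻ y in S, ‖U y‖ₑ ^ 2) ^ (2 / 3 : ℝ) *
        (2 * (∫⁻ y in S, ENNReal.ofReal (frobeniusNormSq (fderiv ℝ U y))) +
          2 * ENNReal.ofReal (d ^ 2) * ∫⁻ y in S, ‖U y‖ₑ ^ 2) :=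
        mul_le_mul' (mul_le_mul' le_rfl (ENNReal.rpow_le_rpow hAle (by norm_num))) hBle

/-- **The shell estimate.** Let `U ∈ C¹` satisfy the energy growth `∫_{B_r} |U|² ≤ C r` for
`r ≥ R₀` and let `C₀` be the cut-off gradient constant. For `R ≥ 1` with `5R ≥ R₀`,
`∫_{R ≤ |y| < 2R} |U|^{10/3} |y|^{-5/3} ≤ K₁ ∫_{R/2 ≤ |y| < 8R} |DU|² min(1, |y|⁻¹) + K₂ R⁻²`
with `K₁ = K² C^{2/3} · 8·5^{2/3}`, `K₂ = K² C^{2/3} C · 10·5^{2/3} (5C₀/2)²` (`K` the GNS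
constant): the one-shell multiplicative inequality with the annular cut-off `η_R`, `|y|^{-5/3} ≤
R^{-5/3}` on the shell, `∫_{|y| ≤ 4R} |U|² ≤ 5CR`, `‖Dη_R‖ ≤ (5C₀/2)/R`, and `1 ≤ 4R min(1, |y|⁻¹)`
for `|y| ≤ 4R` (Tsai 1998, (4.1)–(4.3): this is how the local energy bounds control
`∫ |U|^{10/3} |y|^{-5/3}` shell by shell). [cite: Tsai1998, (4.1)–(4.3) pp. 44–45] -/
theorem setLIntegral_shell_rpow_ten_thirds_le {U : (EuclideanSpace ℝ (Fin 3)) → (EuclideanSpace ℝ (Fin 3))} (hU : ContDiff ℝ 1 U) {C : ℝ≥0∞}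
    {R₀ : ℝ} (hE : ∀ r : ℝ, R₀ ≤ r → ∫⁻ y in ball (0 : (EuclideanSpace ℝ (Fin 3))) r, ‖U y‖ₑ ^ 2 ≤ C * ENNReal.ofReal r)
    {C₀ : ℝ} (hC : ∀ r : ℝ, 0 < r → ∀ x : (EuclideanSpace ℝ (Fin 3)), ‖fderiv ℝ (cutoff r) x‖ ≤ C₀ / r)
    {R : ℝ} (hR1 : 1 ≤ R) (hR0 : R₀ ≤ 5 * R) :
    ∫⁻ y in {y : (EuclideanSpace ℝ (Fin 3)) | R ≤ ‖y‖ ∧ ‖y‖ < 2 * R}, ‖U y‖ₑ ^ (10 / 3 : ℝ) * ‖y‖ₑ ^ (-(5 / 3) : ℝ) ≤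
      (SNormLESNormFDerivOfEqConst (EuclideanSpace ℝ (Fin 3)) (volume : Measure (EuclideanSpace ℝ (Fin 3))) 2 : ℝ≥0∞) ^ 2 * C ^ (2 / 3 : ℝ) *
          ENNReal.ofReal (8 * 5 ^ (2 / 3 : ℝ)) *
          (∫⁻ y in {y : (EuclideanSpace ℝ (Fin 3)) | R / 2 ≤ ‖y‖ ∧ ‖y‖ < 8 * R},
            ENNReal.ofReal (frobeniusNormSq (fderiv ℝ U y)) * ENNReal.ofReal (min 1 ‖y‖⁻¹)) +
        (SNormLESNormFDerivOfEqConst (EuclideanSpace ℝ (Fin 3)) (volume : Measure (EuclideanSpace ℝ (Fin 3))) 2 : ℝ≥0∞) ^ 2 * C ^ (2 / 3 : ℝ) * C *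
          ENNReal.ofReal (10 * 5 ^ (2 / 3 : ℝ) * (5 * C₀ / 2) ^ 2) * ENNReal.ofReal ((R ^ 2)⁻¹) := by
  have hR : 0 < R := one_pos.trans_le hR1
  set Kg : ℝ≥0∞ := (SNormLESNormFDerivOfEqConst (EuclideanSpace ℝ (Fin 3)) (volume : Measure (EuclideanSpace ℝ (Fin 3))) 2 : ℝ≥0∞) with hKg
  set F : (EuclideanSpace ℝ (Fin 3)) → ℝ≥0∞ := fun y => ENNReal.ofReal (frobeniusNormSq (fderiv ℝ U y)) with hF
  set S : Set (EuclideanSpace ℝ (Fin 3)) := {y : (EuclideanSpace ℝ (Fin 3)) | R / 2 ≤ ‖y‖ ∧ ‖y‖ ≤ 4 * R} with hS_def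
  have hS : MeasurableSet S :=
    (measurableSet_le measurable_const measurable_norm).inter
      (measurableSet_le measurable_norm measurable_const)
  set d : ℝ := 5 * C₀ / 2 / R with hd
  set η : (EuclideanSpace ℝ (Fin 3)) → ℝ := fun y => cutoff (2 * R) y - cutoff (R / 2) y with hη
  -- the one-shell multiplicative inequality
  have hη1 : ∀ y, |η y| ≤ S.indicator (fun _ => (1 : ℝ)) y := by
    intro y
    by_cases hy : y ∈ S
    · rw [indicator_of_mem hy]; exact abs_annularCutoff_le_one R y
    · rw [indicator_of_notMem hy]
      have hy' : ‖y‖ < R / 2 ∨ 4 * R < ‖y‖ := by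
        simp only [hS_def, mem_setOf_eq, not_and_or, not_le] at hy; exact hy
      rw [hη]
      simp only [annularCutoff_eq_zero hR hy', abs_zero, le_refl]
  have hDη : ∀ y, ‖fderiv ℝ η y‖ ≤ S.indicator (fun _ => d) y := fun y =>
    norm_fderiv_annularCutoff_le hR hC y
  have hI := lintegral_cutoff_mul_rpow_ten_thirds_le hU (contDiff_annularCutoff R)
    (hasCompactSupport_annularCutoff hR) hS hη1 hDη
  -- `∫_S |U|² ≤ 5 C R`
  have hSball : S ⊆ ball (0 : (EuclideanSpace ℝ (Fin 3))) (5 * R) := fun y hy => mem_ball_zero_iff.2 (by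
    have := hy.2; linarith)
  have hE5 : ∫⁻ y in S, ‖U y‖ₑ ^ 2 ≤ C * ENNReal.ofReal (5 * R) :=
    (lintegral_mono_set hSball).trans (hE _ hR0)
  -- `∫_S |DU|² ≤ 4R ∫_{R/2 ≤ |y| < 8R} |DU|² min(1, |y|⁻¹)`
  have hSann : S ⊆ {y : (EuclideanSpace ℝ (Fin 3)) | R / 2 ≤ ‖y‖ ∧ ‖y‖ < 8 * R} := fun y hy => ⟨hy.1, by
    have := hy.2; linarith⟩
  have hFle : ∫⁻ y in S, F y ≤ ENNReal.ofReal (4 * R) *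
      ∫⁻ y in {y : (EuclideanSpace ℝ (Fin 3)) | R / 2 ≤ ‖y‖ ∧ ‖y‖ < 8 * R}, F y * ENNReal.ofReal (min 1 ‖y‖⁻¹) := by
    rw [← lintegral_const_mul' _ _ ENNReal.ofReal_ne_top]
    refine (setLIntegral_mono' hS fun y hy => ?_).trans (lintegral_mono_set hSann)
    have hw : 1 ≤ 4 * R * min 1 ‖y‖⁻¹ := by
      rcases le_total 1 ‖y‖⁻¹ with h | h
      · rw [min_eq_left h]; linarith
      · rw [min_eq_right h]
        have hy0 : 0 < ‖y‖ := lt_of_lt_of_le (by positivity) hy.1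
        calc (1 : ℝ) = 4 * R * (4 * R)⁻¹ := by field_simp
          _ ≤ 4 * R * ‖y‖⁻¹ := mul_le_mul_of_nonneg_left (inv_anti₀ hy0 hy.2) (by positivity)
    calc F y = F y * 1 := (mul_one _).symm
      _ ≤ F y * ENNReal.ofReal (4 * R * min 1 ‖y‖⁻¹) := by
          refine mul_le_mul' le_rfl ?_
          rw [← ENNReal.ofReal_one]
          exact ENNReal.ofReal_le_ofReal hw
      _ = ENNReal.ofReal (4 * R) * (F y * ENNReal.ofReal (min 1 ‖y‖⁻¹)) := by
          rw [ENNReal.ofReal_mul (by positivity)]; ring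
  set W : ℝ≥0∞ := ∫⁻ y in {y : (EuclideanSpace ℝ (Fin 3)) | R / 2 ≤ ‖y‖ ∧ ‖y‖ < 8 * R}, F y * ENNReal.ofReal (min 1 ‖y‖⁻¹)
    with hW
  -- on the shell, `ηU = U` and `|y|^{-5/3} ≤ R^{-5/3}`
  have hshm : MeasurableSet {y : (EuclideanSpace ℝ (Fin 3)) | R ≤ ‖y‖ ∧ ‖y‖ < 2 * R} :=
    (measurableSet_le measurable_const measurable_norm).inter
      (measurableSet_lt measurable_norm measurable_const)
  have hpt : ∀ y ∈ {y : (EuclideanSpace ℝ (Fin 3)) | R ≤ ‖y‖ ∧ ‖y‖ < 2 * R},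
      ‖U y‖ₑ ^ (10 / 3 : ℝ) * ‖y‖ₑ ^ (-(5 / 3) : ℝ) ≤
        ENNReal.ofReal (R ^ (-(5 / 3) : ℝ)) * ‖η y • U y‖ₑ ^ (10 / 3 : ℝ) := by
    intro y hy
    have hη1' : η y = 1 := annularCutoff_eq_one hR hy.1 hy.2.le
    rw [hη1', one_smul, mul_comm]
    refine mul_le_mul' ?_ le_rfl
    rw [← ENNReal.ofReal_rpow_of_pos hR, ← ofReal_norm, ENNReal.rpow_neg, ENNReal.rpow_neg]
    exact ENNReal.inv_le_inv.2 (ENNReal.rpow_le_rpow (ENNReal.ofReal_le_ofReal hy.1) (by norm_num))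
  -- the real-number bookkeeping of the powers of `R`
  have h1 : R ^ (-(5 / 3) : ℝ) * R ^ (2 / 3 : ℝ) * R = 1 := by
    rw [← Real.rpow_add hR, show (-(5 / 3) : ℝ) + 2 / 3 = -1 by norm_num, Real.rpow_neg_one,
      inv_mul_cancel₀ hR.ne']
  have r1 : R ^ (-(5 / 3) : ℝ) * (5 * R) ^ (2 / 3 : ℝ) * 2 * (4 * R) = 8 * 5 ^ (2 / 3 : ℝ) := by
    rw [Real.mul_rpow (by norm_num) hR.le]
    linear_combination (8 * 5 ^ (2 / 3 : ℝ)) * h1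
  have r2 : R ^ (-(5 / 3) : ℝ) * (5 * R) ^ (2 / 3 : ℝ) * 2 * d ^ 2 * (5 * R) =
      10 * 5 ^ (2 / 3 : ℝ) * (5 * C₀ / 2) ^ 2 * (R ^ 2)⁻¹ := by
    have hd2 : d ^ 2 = (5 * C₀ / 2) ^ 2 * (R ^ 2)⁻¹ := by rw [hd, div_pow, div_eq_mul_inv]
    rw [Real.mul_rpow (by norm_num) hR.le, hd2]
    linear_combination (10 * 5 ^ (2 / 3 : ℝ) * (5 * C₀ / 2) ^ 2 * (R ^ 2)⁻¹) * h1
  have e1 : ENNReal.ofReal (R ^ (-(5 / 3) : ℝ)) * ENNReal.ofReal ((5 * R) ^ (2 / 3 : ℝ)) * 2 *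
      ENNReal.ofReal (4 * R) = ENNReal.ofReal (8 * 5 ^ (2 / 3 : ℝ)) := by
    rw [← r1]
    symm
    rw [ENNReal.ofReal_mul (by positivity), ENNReal.ofReal_mul (by positivity),
      ENNReal.ofReal_mul (by positivity), ENNReal.ofReal_ofNat]
  have e2 : ENNReal.ofReal (R ^ (-(5 / 3) : ℝ)) * ENNReal.ofReal ((5 * R) ^ (2 / 3 : ℝ)) * 2 *
      ENNReal.ofReal (d ^ 2) * ENNReal.ofReal (5 * R) =
      ENNReal.ofReal (10 * 5 ^ (2 / 3 : ℝ) * (5 * C₀ / 2) ^ 2) * ENNReal.ofReal ((R ^ 2)⁻¹) := by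
    rw [← ENNReal.ofReal_mul (p := 10 * 5 ^ (2 / 3 : ℝ) * (5 * C₀ / 2) ^ 2) (by positivity), ← r2]
    symm
    rw [ENNReal.ofReal_mul (by positivity), ENNReal.ofReal_mul (by positivity),
      ENNReal.ofReal_mul (by positivity), ENNReal.ofReal_mul (by positivity), ENNReal.ofReal_ofNat]
  -- assemble
  calc ∫⁻ y in {y : (EuclideanSpace ℝ (Fin 3)) | R ≤ ‖y‖ ∧ ‖y‖ < 2 * R}, ‖U y‖ₑ ^ (10 / 3 : ℝ) * ‖y‖ₑ ^ (-(5 / 3) : ℝ)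
      ≤ ∫⁻ y in {y : (EuclideanSpace ℝ (Fin 3)) | R ≤ ‖y‖ ∧ ‖y‖ < 2 * R},
          ENNReal.ofReal (R ^ (-(5 / 3) : ℝ)) * ‖η y • U y‖ₑ ^ (10 / 3 : ℝ) := setLIntegral_mono' hshm hpt
    _ ≤ ENNReal.ofReal (R ^ (-(5 / 3) : ℝ)) * ∫⁻ y, ‖η y • U y‖ₑ ^ (10 / 3 : ℝ) := by
        rw [lintegral_const_mul' _ _ ENNReal.ofReal_ne_top]
        exact mul_le_mul' le_rfl (setLIntegral_le_lintegral _ _)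
    _ ≤ ENNReal.ofReal (R ^ (-(5 / 3) : ℝ)) * (Kg ^ 2 * (C * ENNReal.ofReal (5 * R)) ^ (2 / 3 : ℝ) *
          (2 * (ENNReal.ofReal (4 * R) * W) + 2 * ENNReal.ofReal (d ^ 2) * (C * ENNReal.ofReal (5 * R)))) := by
        refine mul_le_mul' le_rfl (hI.trans ?_)
        refine mul_le_mul' (mul_le_mul' le_rfl (ENNReal.rpow_le_rpow hE5 (by norm_num))) ?_
        exact add_le_add (mul_le_mul' le_rfl hFle) (mul_le_mul' le_rfl hE5)
    _ = Kg ^ 2 * C ^ (2 / 3 : ℝ) * (ENNReal.ofReal (R ^ (-(5 / 3) : ℝ)) *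
            ENNReal.ofReal ((5 * R) ^ (2 / 3 : ℝ)) * 2 * ENNReal.ofReal (4 * R)) * W +
          Kg ^ 2 * C ^ (2 / 3 : ℝ) * C * (ENNReal.ofReal (R ^ (-(5 / 3) : ℝ)) *
            ENNReal.ofReal ((5 * R) ^ (2 / 3 : ℝ)) * 2 * ENNReal.ofReal (d ^ 2) * ENNReal.ofReal (5 * R)) := by
        rw [ENNReal.mul_rpow_of_nonneg _ _ (by norm_num),
          ENNReal.ofReal_rpow_of_nonneg (by positivity) (by norm_num)]
        ring
    _ = _ := by rw [e1, e2]; ring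

end Shell

/-! ### Tsai 1998, (4.3): `∫ |U|^{10/3} |y|^{-5/3} dy < ∞` -/

section Main

/-- `∫_{B_r} |y|^{-5/3} dy < ∞` on `ℝ³` (`5/3 < 3`; Mathlib `integrableOn_ball_of_norm_le_rpow`). [folklore] -/
theorem setLIntegral_ball_enorm_rpow_neg_lt_top (r : ℝ) :
    ∫⁻ y in ball (0 : (EuclideanSpace ℝ (Fin 3))) r, ‖y‖ₑ ^ (-(5 / 3) : ℝ) < ∞ := by
  set f : (EuclideanSpace ℝ (Fin 3)) → ℝ := fun y => ‖y‖ ^ (-(5 / 3) : ℝ) with hf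
  have hd : 1 ≤ Module.finrank ℝ (EuclideanSpace ℝ (Fin 3)) := by rw [finrank_euclideanSpace_fin]; norm_num
  have hα : (5 / 3 : ℝ) < Module.finrank ℝ (EuclideanSpace ℝ (Fin 3)) := by rw [finrank_euclideanSpace_fin]; norm_num
  have hmeas : AEStronglyMeasurable f (volume : Measure (EuclideanSpace ℝ (Fin 3))) :=
    (measurable_norm.pow_const _).aestronglyMeasurable
  have hint : IntegrableOn f (ball (0 : (EuclideanSpace ℝ (Fin 3))) r) volume :=
    integrableOn_ball_of_norm_le_rpow hd hα (C := 1) (Eventually.of_forall fun y => by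
      rw [hf, one_mul, Real.norm_of_nonneg (Real.rpow_nonneg (norm_nonneg _) _)]) hmeas
  have hae : ∀ᵐ y ∂(volume.restrict (ball (0 : (EuclideanSpace ℝ (Fin 3))) r)), ‖y‖ₑ ^ (-(5 / 3) : ℝ) = ‖f y‖ₑ := by
    have h0 : ∀ᵐ y ∂(volume : Measure (EuclideanSpace ℝ (Fin 3))), y ≠ 0 := by
      rw [ae_iff]
      simp only [ne_eq, not_not, setOf_eq_eq_singleton, measure_singleton]
    filter_upwards [ae_restrict_of_ae h0] with y hy
    rw [hf]
    simp only
    rw [Real.enorm_eq_ofReal (Real.rpow_nonneg (norm_nonneg _) _),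
      ← ENNReal.ofReal_rpow_of_pos (norm_pos_iff.2 hy), ofReal_norm]
  rw [lintegral_congr_ae hae]
  exact hint.2

/-- **Tsai 1998, (4.3)** for a `C¹` profile. If `∫_{B_r} |U|² ≤ C r` for `r ≥ R₀` ((4.1)₁) and
`∫ |DU|² min(1, |y|⁻¹) dy < ∞` ((4.1)₂), then `∫ |U(y)|^{10/3} |y|^{-5/3} dy < ∞` — the weighted
integrability (4.3) with Tsai's `A_{5/3}` weight `w = |y|^{-5/3}` (p. 44–45: "By [CKN, p. 781],
(1.4) implies `‖u‖_{10/3,Q₁} < ∞` … Since `U` is smooth, the condition (4.1)₂ `< ∞` implies (4.3)").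
Here the parabolic interpolation behind [CKN, p. 781] is carried out directly in the profile
variables: the ball `B_{R₁}`, `R₁ = max(R₀, 1)`, contributes `≤ sup_{B_{R₁}} |U|^{10/3} ∫_{B_{R₁}}
|y|^{-5/3} < ∞`, and the dyadic shells are summed with `setLIntegral_shell_rpow_ten_thirds_le`
and `setLIntegral_lt_top_of_dyadic`. [cite: Tsai1998, (4.1)–(4.3) pp. 44–45] -/
theorem lintegral_rpow_ten_thirds_weight_lt_top {U : (EuclideanSpace ℝ (Fin 3)) → (EuclideanSpace ℝ (Fin 3))} (hU : ContDiff ℝ 1 U) {C : ℝ≥0∞}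
    (hC : C ≠ ∞) {R₀ : ℝ}
    (hE : ∀ r : ℝ, R₀ ≤ r → ∫⁻ y in ball (0 : (EuclideanSpace ℝ (Fin 3))) r, ‖U y‖ₑ ^ 2 ≤ C * ENNReal.ofReal r)
    (hG : ∫⁻ y, ENNReal.ofReal (frobeniusNormSq (fderiv ℝ U y)) * ENNReal.ofReal (min 1 ‖y‖⁻¹) < ∞) :
    ∫⁻ y, ‖U y‖ₑ ^ (10 / 3 : ℝ) * ‖y‖ₑ ^ (-(5 / 3) : ℝ) < ∞ := by
  obtain ⟨C₀, -, hCut⟩ := exists_norm_fderiv_cutoff_le (E := (EuclideanSpace ℝ (Fin 3)))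
  set R₁ : ℝ := max R₀ 1 with hR₁
  have hR₁1 : 1 ≤ R₁ := le_max_right _ _
  have hR₁0 : 0 < R₁ := one_pos.trans_le hR₁1
  have hR₁R₀ : R₀ ≤ R₁ := le_max_left _ _
  set g : (EuclideanSpace ℝ (Fin 3)) → ℝ≥0∞ := fun y => ‖U y‖ₑ ^ (10 / 3 : ℝ) * ‖y‖ₑ ^ (-(5 / 3) : ℝ) with hg
  rw [← lintegral_add_compl g measurableSet_ball (μ := volume) (A := ball (0 : (EuclideanSpace ℝ (Fin 3))) R₁)]
  refine ENNReal.add_lt_top.2 ⟨?_, ?_⟩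
  · -- the ball `B_{R₁}`: `U` is bounded there
    obtain ⟨M, hM⟩ := (isCompact_closedBall (0 : (EuclideanSpace ℝ (Fin 3))) R₁).exists_bound_of_continuousOn
      hU.continuous.continuousOn
    have hM0 : 0 ≤ max M 0 := le_max_right _ _
    calc ∫⁻ y in ball (0 : (EuclideanSpace ℝ (Fin 3))) R₁, g y
        ≤ ∫⁻ y in ball (0 : (EuclideanSpace ℝ (Fin 3))) R₁, ENNReal.ofReal (max M 0) ^ (10 / 3 : ℝ) * ‖y‖ₑ ^ (-(5 / 3) : ℝ) := by
          refine setLIntegral_mono' measurableSet_ball fun y hy => mul_le_mul' ?_ le_rfl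
          refine ENNReal.rpow_le_rpow ?_ (by norm_num)
          rw [← ofReal_norm]
          exact ENNReal.ofReal_le_ofReal ((hM y (ball_subset_closedBall hy)).trans (le_max_left _ _))
      _ = ENNReal.ofReal (max M 0) ^ (10 / 3 : ℝ) * ∫⁻ y in ball (0 : (EuclideanSpace ℝ (Fin 3))) R₁, ‖y‖ₑ ^ (-(5 / 3) : ℝ) :=
          lintegral_const_mul' _ _ (ENNReal.rpow_ne_top_of_nonneg (by norm_num) ENNReal.ofReal_ne_top)
      _ < ∞ := ENNReal.mul_lt_top (ENNReal.rpow_lt_top_of_nonneg (by norm_num) ENNReal.ofReal_ne_top)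
          (setLIntegral_ball_enorm_rpow_neg_lt_top R₁)
  · -- the dyadic shells
    have hcompl : (ball (0 : (EuclideanSpace ℝ (Fin 3))) R₁)ᶜ = {y : (EuclideanSpace ℝ (Fin 3)) | R₁ ≤ ‖y‖} := by
      ext y; simp [not_lt]
    rw [hcompl]
    set Kg : ℝ≥0∞ := (SNormLESNormFDerivOfEqConst (EuclideanSpace ℝ (Fin 3)) (volume : Measure (EuclideanSpace ℝ (Fin 3))) 2 : ℝ≥0∞) with hKg
    refine setLIntegral_lt_top_of_dyadic hR₁0
      (K₁ := Kg ^ 2 * C ^ (2 / 3 : ℝ) * ENNReal.ofReal (8 * 5 ^ (2 / 3 : ℝ)))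
      (K₂ := Kg ^ 2 * C ^ (2 / 3 : ℝ) * C * ENNReal.ofReal (10 * 5 ^ (2 / 3 : ℝ) * (5 * C₀ / 2) ^ 2) *
        ENNReal.ofReal ((R₁ ^ 2)⁻¹))
      (h := fun y => ENNReal.ofReal (frobeniusNormSq (fderiv ℝ U y)) * ENNReal.ofReal (min 1 ‖y‖⁻¹))
      ?_ ?_ hG fun k => ?_
    · exact ENNReal.mul_ne_top (ENNReal.mul_ne_top (ENNReal.pow_ne_top ENNReal.coe_ne_top)
        (ENNReal.rpow_ne_top_of_nonneg (by norm_num) hC)) ENNReal.ofReal_ne_top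
    · exact ENNReal.mul_ne_top (ENNReal.mul_ne_top (ENNReal.mul_ne_top (ENNReal.mul_ne_top
        (ENNReal.pow_ne_top ENNReal.coe_ne_top) (ENNReal.rpow_ne_top_of_nonneg (by norm_num) hC)) hC)
        ENNReal.ofReal_ne_top) ENNReal.ofReal_ne_top
    · have hRk : 1 ≤ R₁ * 2 ^ k :=
        hR₁1.trans (le_mul_of_one_le_right hR₁0.le (one_le_pow₀ one_le_two))
      have hRk0 : R₀ ≤ 5 * (R₁ * 2 ^ k) := by
        have : R₁ ≤ R₁ * 2 ^ k := le_mul_of_one_le_right hR₁0.le (one_le_pow₀ one_le_two)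
        nlinarith
      have h := setLIntegral_shell_rpow_ten_thirds_le hU hE hCut hRk hRk0
      have hs1 : {y : (EuclideanSpace ℝ (Fin 3)) | R₁ * 2 ^ k ≤ ‖y‖ ∧ ‖y‖ < R₁ * 2 ^ (k + 1)} =
          {y : (EuclideanSpace ℝ (Fin 3)) | R₁ * 2 ^ k ≤ ‖y‖ ∧ ‖y‖ < 2 * (R₁ * 2 ^ k)} := by
        simp only [show (R₁ * 2 ^ (k + 1) : ℝ) = 2 * (R₁ * 2 ^ k) from by ring]
      have hs2 : {y : (EuclideanSpace ℝ (Fin 3)) | R₁ * 2 ^ k / 2 ≤ ‖y‖ ∧ ‖y‖ < R₁ * 2 ^ (k + 3)} =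
          {y : (EuclideanSpace ℝ (Fin 3)) | R₁ * 2 ^ k / 2 ≤ ‖y‖ ∧ ‖y‖ < 8 * (R₁ * 2 ^ k)} := by
        simp only [show (R₁ * 2 ^ (k + 3) : ℝ) = 8 * (R₁ * 2 ^ k) from by ring]
      have h22 : ((2 : ℝ) ^ k) ^ 2 = 4 ^ k := by rw [← pow_mul, mul_comm, pow_mul]; norm_num
      have hreal : (((R₁ * 2 ^ k) ^ 2)⁻¹ : ℝ) = (R₁ ^ 2)⁻¹ * (4⁻¹) ^ k := by
        rw [mul_pow, mul_inv, h22, inv_pow]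
      have hK2 : ENNReal.ofReal (((R₁ * 2 ^ k) ^ 2)⁻¹) = ENNReal.ofReal ((R₁ ^ 2)⁻¹) * (4⁻¹ : ℝ≥0∞) ^ k := by
        rw [hreal, ENNReal.ofReal_mul (by positivity), ENNReal.ofReal_pow (by norm_num),
          ENNReal.ofReal_inv_of_pos (by norm_num : (0 : ℝ) < 4), ENNReal.ofReal_ofNat]
      rw [hs1, hs2]
      refine h.trans (le_of_eq ?_)
      rw [hK2]
      ring

end Main

end Literature.Analysis.FluidPDE

end
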